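import Summits.ResolutionOfSingularities.ResolutionOfSingularities.Theses.RadicialJung
import Literature.AlgebraicGeometry.Resolution.ProjectiveSpaceRegular

/-!
# `CleanModels` — negative lemmas I: load-bearing hypotheses, the generic point, non-vacuity

Support (negative) lemmas for crux `stmt-ResolutionOfSingularities-15917`
(`Summit.ResolutionOfSingularities.ResolutionOfSingularities.Theses.RadicialJung.CleanModels`: for every
prime `p`, every field `k` of characteristic `p`, every regular integral separated finite-type `W/k` and
every purely inseparable degree-`p` extension `L/K(W)`, some proper birational regular `π : V → W` is
pointwise LOG-CLEAN — at each `v ∈ V` some `g = y^p ∈ L^p ∖ K(W)^p` pulls back to `∏_{i<m} t_i^{a_i}`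
on a regular system of parameters with `0 < m`, `p ∤ a_i` (toroidal type), or to a unit `u₀` that is
residually not a `p`-th power or has `u₀ − c^p ∈ 𝔪 ∖ 𝔪²` (regular type)), filed by the standing
disprover (cdisprove cycle 1; work file `Cruxes/CleanModels/Disproof.lean`, which carries the full
analysis). This file declares NO definition: every variant statement is written out inline, and NO
declaration concludes the route decl `CleanModels` positively.

* `cleanModels_false_without_finrank` — with `Module.finrank K(W) L = p` dropped the statement is
  FALSE: `W = Spec 𝔽₂`, `L = K(W)` itself (purely inseparable over itself), where no `y ∈ L` lies
  outside `K(W)`. The degree hypothesis is what makes `L ≠ K(W)`.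
* `cleanModels_false_without_isPurelyInseparable` — with `IsPurelyInseparable K(W) L` dropped it is
  FALSE: `W = Spec 𝔽₂` (`K(W) = 𝔽₂`), `L = 𝔽₄` of degree `2`; in `𝔽₄`, `y = y⁴ = (y²)²`, so
  `y² ∈ K(W)` forces `y ∈ K(W)`.
* `cleanModels_toroidal_false_at_genericPoint` — TIGHTNESS: at the generic point of ANY model `V` the
  toroidal branch is impossible (`𝒪_{V,ξ} = K(V)` is a field: `dim = 0 < m ≤ d = dim`), so every proof
  of the crux must use the regular branch (i) there.
* `cleanModels_hypotheses_satisfiable` — NON-VACUITY in Lean: the hypotheses are met by `p = 2`,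
  `k = 𝔽₂(s)`, `W = Spec k`, `L = K(W)[y]/(y² − s)` (degree `2`, purely inseparable).
* `not_cleanModels_toroidalOnly` — the natural strengthening "toroidal type at EVERY point" (regular
  branch deleted) is FALSE (the two previous lemmas).

## Sources
* J. Giraud, *Condition de Jung pour les revêtements radiciels de hauteur un*, LNM 1016 (1983) 313–333;
  Q. Posva, *Resolution of 1-foliations singularities on surfaces and threefolds*, arXiv:2405.05735, Thm 1
  (the dimension-≤ 3, étale-local, `k = k̄` form of the crux).
* The Stacks Project, Tags 01RN (birational), 02IS (regular schemes).
-/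

noncomputable section

set_option linter.dupNamespace false -- mandated namespace of this single-conjunct summit

open CategoryTheory AlgebraicGeometry
open Literature.AlgebraicGeometry.Resolution Literature.AlgebraicGeometry.Motives
open Summit.ResolutionOfSingularities.ResolutionOfSingularities.Theses.RadicialJung

namespace Summit.ResolutionOfSingularities.ResolutionOfSingularities.Theorems.CleanModels.Negative

/-- **The degree hypothesis is load-bearing.** `CleanModels` with `Module.finrank K(W) L = p` dropped
is false: `p = 2`, `k = 𝔽₂`, `W = Spec 𝔽₂`, `L = K(W)` (purely inseparable over itself) — no `y ∈ L`
lies outside the image of `K(W)`, so the point condition fails at the (unique) point of any model.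
[folklore] -/
theorem cleanModels_false_without_finrank :
    ¬ (∀ p : ℕ, p.Prime → ∀ (k : Type) [Field k] [CharP k p] (W : Scheme.{0}) [IsIntegral W]
        (f : W ⟶ Spec (.of k)) (L : Type) [Field L] [Algebra W.functionField L],
        IsSeparated f → LocallyOfFiniteType f → QuasiCompact f → Scheme.IsRegular W →
        IsPurelyInseparable W.functionField L →
        ∃ (V : Scheme.{0}) (π : V ⟶ W) (_ : IsIntegral V) (_ : IsDominant π),
          IsProper π ∧ IsBirational π ∧ Scheme.IsRegular V ∧
          (∀ v : V, (∃ (y : L) (g : W.functionField),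
            y ∉ Set.range (algebraMap W.functionField L) ∧ algebraMap W.functionField L g = y ^ p ∧
            ((∃ (d m : ℕ) (hmd : m ≤ d) (t : Fin d → V.presheaf.stalk v) (a : Fin m → ℕ),
                Ideal.span (Set.range t) = IsLocalRing.maximalIdeal (V.presheaf.stalk v) ∧
                ringKrullDim (V.presheaf.stalk v) = (d : WithBot ℕ∞) ∧ 0 < m ∧ (∀ i, ¬ p ∣ a i) ∧
                RatFn.functionFieldMap π g = ∏ i : Fin m,
                  (algebraMap (V.presheaf.stalk v) V.functionField (t (Fin.castLE hmd i))) ^ (a i)) ∨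
             (∃ u₀ : V.presheaf.stalk v, IsUnit u₀ ∧
                RatFn.functionFieldMap π g = algebraMap (V.presheaf.stalk v) V.functionField u₀ ∧
                ((∀ c : V.presheaf.stalk v,
                    u₀ - c ^ p ∉ IsLocalRing.maximalIdeal (V.presheaf.stalk v)) ∨
                 (∃ c : V.presheaf.stalk v,
                    u₀ - c ^ p ∈ IsLocalRing.maximalIdeal (V.presheaf.stalk v) ∧
                    u₀ - c ^ p ∉ IsLocalRing.maximalIdeal (V.presheaf.stalk v) ^ 2))))))) := by
  intro h
  have hreg : Scheme.IsRegular (Spec (.of (ZMod 2))) := Scheme.isRegular_Spec (.of (ZMod 2))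
  obtain ⟨V, π, hV, _, -, -, -, hpt⟩ :=
    @h 2 Nat.prime_two (ZMod 2) _ _ (Spec (.of (ZMod 2))) _ (𝟙 _)
      (Spec (.of (ZMod 2))).functionField _ (Algebra.id _)
      inferInstance inferInstance inferInstance hreg inferInstance
  obtain ⟨y, g, hy, -, -⟩ := hpt (hV.nonempty.some)
  exact hy ⟨y, rfl⟩

/-- **Pure inseparability is load-bearing.** `CleanModels` with `IsPurelyInseparable K(W) L` dropped is
false: `p = 2`, `k = 𝔽₂`, `W = Spec 𝔽₂` (so `K(W) = 𝔽₂`), `L = 𝔽₄` (degree `2`, separable): in `𝔽₄`,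
`y = y⁴ = (y²)²`, so `y² = g ∈ K(W)` gives `y = g² ∈ K(W)`, and no `y` as demanded exists. [folklore] -/
theorem cleanModels_false_without_isPurelyInseparable :
    ¬ (∀ p : ℕ, p.Prime → ∀ (k : Type) [Field k] [CharP k p] (W : Scheme.{0}) [IsIntegral W]
        (f : W ⟶ Spec (.of k)) (L : Type) [Field L] [Algebra W.functionField L],
        IsSeparated f → LocallyOfFiniteType f → QuasiCompact f → Scheme.IsRegular W →
        Module.finrank W.functionField L = p →
        ∃ (V : Scheme.{0}) (π : V ⟶ W) (_ : IsIntegral V) (_ : IsDominant π),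
          IsProper π ∧ IsBirational π ∧ Scheme.IsRegular V ∧
          (∀ v : V, (∃ (y : L) (g : W.functionField),
            y ∉ Set.range (algebraMap W.functionField L) ∧ algebraMap W.functionField L g = y ^ p ∧
            ((∃ (d m : ℕ) (hmd : m ≤ d) (t : Fin d → V.presheaf.stalk v) (a : Fin m → ℕ),
                Ideal.span (Set.range t) = IsLocalRing.maximalIdeal (V.presheaf.stalk v) ∧
                ringKrullDim (V.presheaf.stalk v) = (d : WithBot ℕ∞) ∧ 0 < m ∧ (∀ i, ¬ p ∣ a i) ∧
                RatFn.functionFieldMap π g = ∏ i : Fin m,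
                  (algebraMap (V.presheaf.stalk v) V.functionField (t (Fin.castLE hmd i))) ^ (a i)) ∨
             (∃ u₀ : V.presheaf.stalk v, IsUnit u₀ ∧
                RatFn.functionFieldMap π g = algebraMap (V.presheaf.stalk v) V.functionField u₀ ∧
                ((∀ c : V.presheaf.stalk v,
                    u₀ - c ^ p ∉ IsLocalRing.maximalIdeal (V.presheaf.stalk v)) ∨
                 (∃ c : V.presheaf.stalk v,
                    u₀ - c ^ p ∈ IsLocalRing.maximalIdeal (V.presheaf.stalk v) ∧
                    u₀ - c ^ p ∉ IsLocalRing.maximalIdeal (V.presheaf.stalk v) ^ 2))))))) := by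
  intro h
  -- `K = K(Spec 𝔽₂) ≅ 𝔽₂` (a field is its own fraction field; Mathlib's instances are keyed on `↑R`).
  letI : Algebra (ZMod 2) (Spec (.of (ZMod 2))).functionField :=
    AlgebraicGeometry.instAlgebraCarrierFunctionFieldSpec (CommRingCat.of (ZMod 2))
  haveI : IsFractionRing (ZMod 2) (Spec (.of (ZMod 2))).functionField :=
    AlgebraicGeometry.functionField_isFractionRing_of_affine (CommRingCat.of (ZMod 2))
  let e : ZMod 2 ≃+* (Spec (.of (ZMod 2))).functionField :=
    (IsLocalization.atUnits (S := (Spec (.of (ZMod 2))).functionField) (ZMod 2)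
      (nonZeroDivisors (ZMod 2)) (fun _ hx => (IsUnit.mem_submonoid_iff _).mpr
        (isUnit_iff_ne_zero.mpr (nonZeroDivisors.ne_zero hx)))).toRingEquiv
  letI : Algebra (Spec (.of (ZMod 2))).functionField (GaloisField 2 2) :=
    ((algebraMap (ZMod 2) (GaloisField 2 2)).comp e.symm.toRingHom).toAlgebra
  have hfin : Module.finrank (Spec (.of (ZMod 2))).functionField (GaloisField 2 2) = 2 := by
    refine Eq.trans (Algebra.finrank_eq_of_equiv_equiv e (RingEquiv.refl (GaloisField 2 2)) ?_).symm
      (GaloisField.finrank 2 (n := 2) two_ne_zero)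
    ext
    simp [RingHom.algebraMap_toAlgebra]
  have hreg : Scheme.IsRegular (Spec (.of (ZMod 2))) := Scheme.isRegular_Spec (.of (ZMod 2))
  obtain ⟨V, π, hV, _, -, -, -, hpt⟩ :=
    @h 2 Nat.prime_two (ZMod 2) _ _ (Spec (.of (ZMod 2))) _ (𝟙 _) (GaloisField 2 2) _ _
      inferInstance inferInstance inferInstance hreg hfin
  obtain ⟨y, g, hy, hg, -⟩ := hpt (hV.nonempty.some)
  haveI : Fintype (GaloisField 2 2) := Fintype.ofFinite _
  have hcard : Fintype.card (GaloisField 2 2) = 4 := by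
    rw [Fintype.card_eq_nat_card]; exact GaloisField.card 2 2 two_ne_zero
  have hy4 : y ^ 4 = y := by rw [← hcard]; exact FiniteField.pow_card y
  apply hy
  refine ⟨g ^ 2, ?_⟩
  rw [map_pow, hg, ← pow_mul]
  exact hy4

/-- **The toroidal branch is impossible at the generic point.** For any dominant `π : V ⟶ W` of integral
schemes and any `g`, the toroidal clause of `CleanModels` fails at `ξ = genericPoint V`: the stalk there
is the function field, of Krull dimension `0`, while the clause demands `0 < m ≤ d = dim`. Hence every
proof of the crux uses the regular-type branch at `ξ`. [folklore] -/
theorem cleanModels_toroidal_false_at_genericPoint (p : ℕ) {W V : Scheme.{0}} [IsIntegral W]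
    [IsIntegral V] (π : V ⟶ W) [IsDominant π] (g : W.functionField) (v : V)
    (hv : v = genericPoint V) :
    ¬ (∃ (d m : ℕ) (hmd : m ≤ d) (t : Fin d → V.presheaf.stalk v) (a : Fin m → ℕ),
        Ideal.span (Set.range t) = IsLocalRing.maximalIdeal (V.presheaf.stalk v) ∧
        ringKrullDim (V.presheaf.stalk v) = (d : WithBot ℕ∞) ∧ 0 < m ∧ (∀ i, ¬ p ∣ a i) ∧
        RatFn.functionFieldMap π g = ∏ i : Fin m,
          (algebraMap (V.presheaf.stalk v) V.functionField (t (Fin.castLE hmd i))) ^ (a i)) := by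
  subst hv
  rintro ⟨d, m, hmd, t, a, -, hdim, hm, -, -⟩
  have h0 : ringKrullDim (V.presheaf.stalk (genericPoint V)) = 0 :=
    ringKrullDim_eq_zero_of_field V.functionField
  rw [h0] at hdim
  have hd : d = 0 := by exact_mod_cast hdim.symm
  omega

/-- **The hypotheses of `CleanModels` are satisfiable** (non-vacuity, in Lean): they hold for `p = 2`,
`k = 𝔽₂(s)`, `W = Spec k` over `k` by the identity, `L = K(W)[y]/(y² − s)` — `s` is not a square in
`𝔽₂(s) ≅ K(W)` (degree count), so `y² − s` is irreducible, `L` is a field of degree `2`, purely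
inseparable since `y² ∈ K(W)`. [folklore] -/
theorem cleanModels_hypotheses_satisfiable :
    ¬ (∀ p : ℕ, p.Prime → ∀ (k : Type) [Field k] [CharP k p] (W : Scheme.{0}) [IsIntegral W]
        (f : W ⟶ Spec (.of k)) (L : Type) [Field L] [Algebra W.functionField L],
        IsSeparated f → LocallyOfFiniteType f → QuasiCompact f → Scheme.IsRegular W →
        IsPurelyInseparable W.functionField L → Module.finrank W.functionField L = p → False) := by
  intro h
  -- the ground field `k = 𝔽₂(s)` and `K = K(Spec k) ≅ k`
  letI : Algebra (RatFunc (ZMod 2)) (Spec (.of (RatFunc (ZMod 2)))).functionField :=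
    AlgebraicGeometry.instAlgebraCarrierFunctionFieldSpec (CommRingCat.of (RatFunc (ZMod 2)))
  haveI : IsFractionRing (RatFunc (ZMod 2)) (Spec (.of (RatFunc (ZMod 2)))).functionField :=
    AlgebraicGeometry.functionField_isFractionRing_of_affine (CommRingCat.of (RatFunc (ZMod 2)))
  let e : RatFunc (ZMod 2) ≃+* (Spec (.of (RatFunc (ZMod 2)))).functionField :=
    (IsLocalization.atUnits (S := (Spec (.of (RatFunc (ZMod 2)))).functionField) (RatFunc (ZMod 2))
      (nonZeroDivisors (RatFunc (ZMod 2))) (fun _ hx => (IsUnit.mem_submonoid_iff _).mpr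
        (isUnit_iff_ne_zero.mpr (nonZeroDivisors.ne_zero hx)))).toRingEquiv
  haveI : CharP (Spec (.of (RatFunc (ZMod 2)))).functionField 2 :=
    charP_of_injective_ringHom (f := e.toRingHom) e.injective 2
  haveI : ExpChar (Spec (.of (RatFunc (ZMod 2)))).functionField 2 := ExpChar.prime Nat.prime_two
  -- `s` is not a square
  have hX : ∀ b : RatFunc (ZMod 2), b ^ 2 ≠ RatFunc.X := by
    intro b hb
    have hb0 : b ≠ 0 := by
      rintro rfl
      exact RatFunc.X_ne_zero (by simpa using hb.symm)
    have hdeg := congrArg RatFunc.intDegree hb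
    rw [pow_two, RatFunc.intDegree_mul hb0 hb0, RatFunc.intDegree_X] at hdeg
    omega
  have hsK : ∀ b : (Spec (.of (RatFunc (ZMod 2)))).functionField, b ^ 2 ≠ e RatFunc.X := by
    intro b hb
    apply hX (e.symm b)
    apply e.injective
    rw [map_pow, RingEquiv.apply_symm_apply, hb]
  -- `L = K[y]/(y² − s)`
  have hirr : Irreducible (Polynomial.X ^ 2 - Polynomial.C (e RatFunc.X)) :=
    X_pow_sub_C_irreducible_of_prime Nat.prime_two hsK
  haveI : Fact (Irreducible (Polynomial.X ^ 2 - Polynomial.C (e RatFunc.X))) := ⟨hirr⟩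
  have hfin : Module.finrank (Spec (.of (RatFunc (ZMod 2)))).functionField
      (AdjoinRoot (Polynomial.X ^ 2 - Polynomial.C (e RatFunc.X))) = 2 := by
    rw [(AdjoinRoot.powerBasis hirr.ne_zero).finrank, AdjoinRoot.powerBasis_dim]
    exact Polynomial.natDegree_X_pow_sub_C
  have hroot : (AdjoinRoot.root (Polynomial.X ^ 2 - Polynomial.C (e RatFunc.X))) ^ 2 =
      algebraMap _ (AdjoinRoot (Polynomial.X ^ 2 - Polynomial.C (e RatFunc.X))) (e RatFunc.X) := by
    have h0 : AdjoinRoot.mk (Polynomial.X ^ 2 - Polynomial.C (e RatFunc.X))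
        (Polynomial.X ^ 2 - Polynomial.C (e RatFunc.X)) = 0 := AdjoinRoot.mk_self
    rw [map_sub, map_pow, AdjoinRoot.mk_X, AdjoinRoot.mk_C, sub_eq_zero] at h0
    rw [h0, AdjoinRoot.algebraMap_eq]
  haveI : IsPurelyInseparable (Spec (.of (RatFunc (ZMod 2)))).functionField
      (AdjoinRoot (Polynomial.X ^ 2 - Polynomial.C (e RatFunc.X))) := by
    have htop : IsPurelyInseparable (Spec (.of (RatFunc (ZMod 2)))).functionField
        (IntermediateField.adjoin (Spec (.of (RatFunc (ZMod 2)))).functionField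
          {AdjoinRoot.root (Polynomial.X ^ 2 - Polynomial.C (e RatFunc.X))}) := by
      rw [IntermediateField.isPurelyInseparable_adjoin_simple_iff_pow_mem
        (F := (Spec (.of (RatFunc (ZMod 2)))).functionField)
        (E := AdjoinRoot (Polynomial.X ^ 2 - Polynomial.C (e RatFunc.X))) (q := 2)]
      exact ⟨1, ⟨e RatFunc.X, by rw [pow_one, hroot]⟩⟩
    rw [IntermediateField.adjoin_root_eq_top] at htop
    exact IntermediateField.topEquiv.isPurelyInseparable
  have hreg : Scheme.IsRegular (Spec (.of (RatFunc (ZMod 2)))) := Scheme.isRegular_Spec _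
  exact @h 2 Nat.prime_two (RatFunc (ZMod 2)) _ _ (Spec (.of (RatFunc (ZMod 2)))) _ (𝟙 _)
    (AdjoinRoot (Polynomial.X ^ 2 - Polynomial.C (e RatFunc.X))) _ _
    inferInstance inferInstance inferInstance hreg inferInstance hfin

/-- **"Toroidal type at every point" is false.** The strengthening of `CleanModels` obtained by deleting
the regular-type disjunct fails: the hypotheses are satisfiable (`cleanModels_hypotheses_satisfiable`)
and at the generic point of the model the toroidal clause is impossible
(`cleanModels_toroidal_false_at_genericPoint`). So the regular-type branch of the crux is load-bearing.
[folklore] -/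
theorem not_cleanModels_toroidalOnly :
    ¬ (∀ p : ℕ, p.Prime → ∀ (k : Type) [Field k] [CharP k p] (W : Scheme.{0}) [IsIntegral W]
        (f : W ⟶ Spec (.of k)) (L : Type) [Field L] [Algebra W.functionField L],
        IsSeparated f → LocallyOfFiniteType f → QuasiCompact f → Scheme.IsRegular W →
        IsPurelyInseparable W.functionField L → Module.finrank W.functionField L = p →
        ∃ (V : Scheme.{0}) (π : V ⟶ W) (_ : IsIntegral V) (_ : IsDominant π),
          IsProper π ∧ IsBirational π ∧ Scheme.IsRegular V ∧
          (∀ v : V, (∃ (y : L) (g : W.functionField),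
            y ∉ Set.range (algebraMap W.functionField L) ∧ algebraMap W.functionField L g = y ^ p ∧
            (∃ (d m : ℕ) (hmd : m ≤ d) (t : Fin d → V.presheaf.stalk v) (a : Fin m → ℕ),
                Ideal.span (Set.range t) = IsLocalRing.maximalIdeal (V.presheaf.stalk v) ∧
                ringKrullDim (V.presheaf.stalk v) = (d : WithBot ℕ∞) ∧ 0 < m ∧ (∀ i, ¬ p ∣ a i) ∧
                RatFn.functionFieldMap π g = ∏ i : Fin m,
                  (algebraMap (V.presheaf.stalk v) V.functionField (t (Fin.castLE hmd i))) ^ (a i))))) := by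
  intro h
  apply cleanModels_hypotheses_satisfiable
  intro p hp k _ _ W _ f L _ _ hsep hloc hqc hreg hpi hfin
  obtain ⟨V, π, hV, hdom, -, -, -, hpt⟩ := h p hp k W f L hsep hloc hqc hreg hpi hfin
  obtain ⟨y, g, -, -, htor⟩ := hpt (genericPoint V)
  exact cleanModels_toroidal_false_at_genericPoint p π g (genericPoint V) rfl htor

end Summit.ResolutionOfSingularities.ResolutionOfSingularities.Theorems.CleanModels.Negative
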